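import Summits.Ventures.HodgeKum4.Theorems.KummerFixedLocusHilbertKummerTransferLefschetz
import Summits.Ventures.HodgeKum4.Theorems.KummerFixedLocusHilbertKummerTransferGraded
import Summits.Ventures.HodgeKum4.Theorems.LaneVDefs
import HarnessLib

/-!
# V0 (`HilbertKummerTransfer`) — the two implications, given the Galois datum, `b₁(K) = 0` and the transported
# dual Lefschetz operator (cell `hodge-kum4`, lane (V), seat p2)

Route `KummerFixedLocus`, item `HilbertKummerTransfer` (stmt-Ventures-20354).  HONEST FRAMING: the two directions of
V0 as theorems with EXPLICIT hypotheses (the finite Galois cover datum of `Θ : A × K ⟶ H`, a dual Lefschetz operator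
`Λ_A` of the `A`-component `x` of `Θ^* ℓ` with `Θ^* ∘ Λ_H = κ (Λ_A ⊗ 1 + 1 ⊗ Λ_K) κ⁻¹ ∘ Θ^*` — supplied by
`…TransferLefschetz.exists_isDualLefschetz_comp_eq`); the closer `KummerFixedLocusHilbertKummerTransfer.lean` assembles
them.  Nothing about L1 or the Hodge conjecture is proved here.

Notation: `S_H = ⟨H^{≤3}(H)⟩_{(Λ_H, ∪)}` (`LefschetzGenerationHilbAt H Λ_H ↔ S_H = ⊤`), `G_K = θ^*(H^{≤3}(H))`,
`S_K = ⟨G_K⟩_{(Λ_K, ∪)}` (`KummerRangeGeneration j Λ_K ↔ im θ^* ≤ S_K`), `R = im θ^* = fibreRange`,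
`Λ_P = κ (Λ_A ⊗ 1 + 1 ⊗ Λ_K) κ⁻¹`.

* §1 `Λ_P (m × s) = Λ_A m × s + m × Λ_K s`; `κ(H*(A) ⊗ S)` is cup-closed for `S` cup-closed and parity-stable
  (`isCupClosed_map_tensorWith`, the inhomogeneous Koszul rule) and `Λ_P`-stable for `S` `Λ_K`-stable.
* §2 **(⟹) `range_le_opCupSpan_of_eq_top`**: `S_H = ⊤ ⟹ im θ^* ≤ S_K` — `T = (Θ^*)⁻¹ κ(H*(A) ⊗ S_K)` contains
  `H^{≤3}(H)` (degree bookkeeping `totalPullback_ofDegree_mem_map_tensorWith`), is cup-closed and `Λ_H`-stable, so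
  `T = ⊤`; then `θ^* = (1, 𝟙)^* ∘ Θ^*` and `(1, 𝟙)^*(m × s) = c • s`.
* §3 **(⟸) `opCupSpan_eq_top_of_range_le`**: `im θ^* ≤ S_K ⟹ S_H = ⊤` — `U = Θ^*(S_H)` contains `m × 1` for all
  `m ∈ H*(A)` (degrees `≤ 3`: deck-invariant homogeneous classes are `Θ^*` of classes of the same degree; degree `4`:
  `x² ≠ 0` spans `H⁴(A)` since `x` is Lefschetz), and `{s | 1 × s ∈ U} ⊇ S_K ⊇ im θ^* = R` (cup-closed, `Λ_K`-stable
  as `Λ_A 1 = 0`); hence `U ⊇ κ(H*(A) ⊗ R) = im Θ^*` and `S_H = ⊤` by injectivity of `Θ^*`.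
-/

noncomputable section

open CategoryTheory MonoidalCategory CartesianMonoidalCategory DirectSum TensorProduct
open Literature.AlgebraicTopology.SingularHomology
open Literature.AlgebraicGeometry Literature.AlgebraicGeometry.Motives Literature.AlgebraicGeometry.Hyperkaehler
open Literature.AlgebraicGeometry.HilbertScheme Literature.AlgebraicGeometry.HodgeTheory
open Literature.Algebra.Lie (degreeSpace IsZGrading HasLefschetzProperty)

namespace Summit.Ventures.HodgeKum4.HilbertKummer

open scoped MonObj

section Main

variable {A : AbelianVariety ℂ} {K H : SchemeOver ℂ} {n k₀ : ℕ} {Ξ : (A.X ⊗ H).left.IdealSheafData}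
  {act : A.X ⊗ H ⟶ H} {j : K ⟶ H}
  {G : Type} [Group G] [Fintype G] [MulAction G (ComplexPoints (A.X ⊗ K))]
  (c : FiniteDeckCover G (ComplexPoints (A.X ⊗ K)) (ComplexPoints H))
  (hc : c.proj = AlgPoints.mapContinuous (L := ℂ) (kummerCover act j))
  (hdeck : ∀ g : G, ∃ (b : 𝟙_ (SchemeOver ℂ) ⟶ A.X) (τ : K ⟶ K),
    c.deck g = AlgPoints.mapContinuous (L := ℂ) (A.translate b⁻¹ ⊗ₘ τ))
  (hS : IsSmoothProjective 2 A.X) (hK : IsSmoothProjective (2 * n) K) (hH : IsHilbertSchemeOfPoints k₀ A.X H Ξ)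
  (hact : IsTranslationAction Ξ act)
  {x : complexBetti A.X 2} {Λ_A : Module.End ℂ (totalCohomology ℂ (ComplexPoints A.X))}
  {Λ_K : Module.End ℂ (totalCohomology ℂ (ComplexPoints K))}

/-! ### §1 `Λ_P` on cross products; `κ(H*(A) ⊗ S)` is cup-closed and `Λ_P`-stable -/

/-- **`Λ_P (m × s) = Λ_A m × s + m × Λ_K s`** for `Λ_P = κ (Λ_A ⊗ 1 + 1 ⊗ Λ_K) κ⁻¹`. -/
theorem conj_kunnethCross_tmul (m : totalCohomology ℂ (ComplexPoints A.X)) (s : totalCohomology ℂ (ComplexPoints K)) :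
    (kunnethEquiv hS hK).conj (Λ_A.rTensor _ + Λ_K.lTensor _) (kunnethCross A.X K (m ⊗ₜ s)) =
      kunnethCross A.X K (Λ_A m ⊗ₜ s) + kunnethCross A.X K (m ⊗ₜ Λ_K s) := by
  rw [LinearEquiv.conj_apply_apply, ← kunnethEquiv_apply hS hK, LinearEquiv.symm_apply_apply, LinearMap.add_apply,
    LinearMap.rTensor_tmul, LinearMap.lTensor_tmul, map_add, kunnethEquiv_apply, kunnethEquiv_apply]

/-- **`κ(H*(A) ⊗ S)` is cup-closed** for `S ⊆ H*(K)` cup-closed and stable under the parity operator (inhomogeneous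
Koszul rule `(m × s) ⌣ (a' × s') = (m ⌣ a') × (P^{|a'|} s ⌣ s')`). -/
theorem isCupClosed_map_tensorWith {S : Submodule ℂ (totalCohomology ℂ (ComplexPoints K))} (hSc : IsCupClosed S)
    (hSP : ∀ (i : ℕ), ∀ s ∈ S, (parityOp ℂ (ComplexPoints K) ^ i) s ∈ S) :
    IsCupClosed ((tensorWith (totalCohomology ℂ (ComplexPoints A.X)) S).map (kunnethCross A.X K)) := by
  rintro _ ⟨t, ht, rfl⟩ _ ⟨t', ht', rfl⟩
  induction ht using Submodule.span_induction generalizing t' with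
  | zero => rw [map_zero, LinearMap.map_zero, LinearMap.zero_apply]; exact Submodule.zero_mem _
  | add u u' _ _ hu hu' => rw [map_add, LinearMap.map_add, LinearMap.add_apply]; exact Submodule.add_mem _ (hu t' ht') (hu' t' ht')
  | smul r u _ hu => rw [map_smul, LinearMap.map_smul, LinearMap.smul_apply]; exact Submodule.smul_mem _ r (hu t' ht')
  | mem u hu =>
    obtain ⟨m, s, hs, rfl⟩ := hu
    induction ht' using Submodule.span_induction with
    | zero => rw [map_zero, map_zero]; exact Submodule.zero_mem _
    | add v v' _ _ hv hv' => rw [map_add, map_add]; exact Submodule.add_mem _ hv hv'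
    | smul r v _ hv => rw [map_smul, map_smul]; exact Submodule.smul_mem _ r hv
    | mem v hv =>
      obtain ⟨m', s', hs', rfl⟩ := hv
      -- decompose `m'` into homogeneous components
      induction m' using DirectSum.induction_on with
      | zero => rw [zero_tmul, map_zero, map_zero]; exact Submodule.zero_mem _
      | add y y' hy hy' => rw [add_tmul, map_add, map_add]; exact Submodule.add_mem _ hy hy'
      | of i a' =>
        rw [← lof_eq_of ℂ]
        change totalCup ℂ _ (kunnethCross A.X K (m ⊗ₜ s)) (kunnethCross A.X K (ofDegree ℂ _ i a' ⊗ₜ s')) ∈ _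
        rw [totalCup_totalCross_tmul_parity]
        exact Submodule.mem_map_of_mem (tmul_mem_tensorWith _ (hSc _ (hSP i s hs) _ hs'))

/-- **`κ(H*(A) ⊗ S)` is `Λ_P`-stable** for `S` `Λ_K`-stable. -/
theorem conj_mem_map_tensorWith {S : Submodule ℂ (totalCohomology ℂ (ComplexPoints K))} (hSΛ : ∀ s ∈ S, Λ_K s ∈ S)
    {v : totalCohomology ℂ (ComplexPoints (A.X ⊗ K))}
    (hv : v ∈ (tensorWith (totalCohomology ℂ (ComplexPoints A.X)) S).map (kunnethCross A.X K)) :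
    (kunnethEquiv hS hK).conj (Λ_A.rTensor _ + Λ_K.lTensor _) v ∈
      (tensorWith (totalCohomology ℂ (ComplexPoints A.X)) S).map (kunnethCross A.X K) := by
  set ΛP := (kunnethEquiv hS hK).conj (Λ_A.rTensor _ + Λ_K.lTensor _) with hΛP
  obtain ⟨t, ht, rfl⟩ := hv
  induction ht using Submodule.span_induction with
  | zero => rw [map_zero, map_zero]; exact Submodule.zero_mem _
  | add u u' _ _ hu hu' => rw [map_add, map_add]; exact Submodule.add_mem _ hu hu'
  | smul r u _ hu => rw [map_smul, map_smul]; exact Submodule.smul_mem _ r hu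
  | mem u hu =>
    obtain ⟨m, s, hs, rfl⟩ := hu
    rw [hΛP, conj_kunnethCross_tmul]
    exact Submodule.add_mem _ (Submodule.mem_map_of_mem (tmul_mem_tensorWith _ hs))
      (Submodule.mem_map_of_mem (tmul_mem_tensorWith _ (hSΛ s hs)))

include hK in
/-- `(1, 𝟙)^*` maps `κ(H*(A) ⊗ S)` into `S` (`(1, 𝟙)^*(m × s) = c • s`). -/
theorem totalPullback_sliceRight_mem {S : Submodule ℂ (totalCohomology ℂ (ComplexPoints K))}
    {v : totalCohomology ℂ (ComplexPoints (A.X ⊗ K))}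
    (hv : v ∈ (tensorWith (totalCohomology ℂ (ComplexPoints A.X)) S).map (kunnethCross A.X K)) :
    totalPullback ℂ (AlgPoints.mapContinuous (L := ℂ) (Motives.sliceRight (1 : 𝟙_ (SchemeOver ℂ) ⟶ A.X) K)) v ∈ S := by
  obtain ⟨t, ht, rfl⟩ := hv
  induction ht using Submodule.span_induction with
  | zero => rw [map_zero, map_zero]; exact S.zero_mem
  | add u u' _ _ hu hu' => rw [map_add, map_add]; exact S.add_mem hu hu'
  | smul r u _ hu => rw [map_smul, map_smul]; exact S.smul_mem r hu
  | mem u hu =>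
    obtain ⟨m, s, hs, rfl⟩ := hu
    obtain ⟨c', hc'⟩ := exists_totalPullback_sliceRight_kunnethCross hK (1 : 𝟙_ (SchemeOver ℂ) ⟶ A.X) m s
    rw [hc']
    exact S.smul_mem c' hs

/-! ### §2 (⟹): `S_H = ⊤ ⟹ im θ^* ≤ S_K` -/

include c hc hdeck hS hK hH hact in
/-- **(⟹)** For the Galois datum, `K` smooth projective, and the transported operator: if
`⟨H^{≤3}(H)⟩_{(Λ_H, ∪)} = H*(H)` then `im θ^* ⊆ ⟨θ^* H^{≤3}(H)⟩_{(Λ_K, ∪)}`. -/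
theorem range_le_opCupSpan_of_eq_top (ℓ : complexBetti H 2) {Λ_H : Module.End ℂ (totalCohomology ℂ (ComplexPoints H))}
    (hΛK : IsDualLefschetz (2 * n) (complexBetti.map j 2 ℓ) Λ_K)
    (hcomm : totalPullback ℂ (AlgPoints.mapContinuous (L := ℂ) (kummerCover act j)) ∘ₗ Λ_H =
      ((kunnethEquiv hS hK).conj (Λ_A.rTensor _ + Λ_K.lTensor _)) ∘ₗ
        totalPullback ℂ (AlgPoints.mapContinuous (L := ℂ) (kummerCover act j)))
    (hgen : opCupSpan ℂ (ComplexPoints H) Λ_H (degreeClasses ℂ (ComplexPoints H) {0, 1, 2, 3}) = ⊤) :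
    LinearMap.range (totalPullback ℂ (AlgPoints.mapContinuous (L := ℂ) j)) ≤
      opCupSpan ℂ (ComplexPoints K) Λ_K
        (totalPullback ℂ (AlgPoints.mapContinuous (L := ℂ) j) '' degreeClasses ℂ (ComplexPoints H) {0, 1, 2, 3}) := by
  haveI := finite_totalCohomology hK
  set SK := opCupSpan ℂ (ComplexPoints K) Λ_K
    (totalPullback ℂ (AlgPoints.mapContinuous (L := ℂ) j) '' degreeClasses ℂ (ComplexPoints H) {0, 1, 2, 3}) with hSK
  set SP := (tensorWith (totalCohomology ℂ (ComplexPoints A.X)) SK).map (kunnethCross A.X K) with hSP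
  set T := SP.comap (totalPullback ℂ (AlgPoints.mapContinuous (L := ℂ) (kummerCover act j))) with hT
  -- `S_K` is cup-closed, `Λ_K`-stable and parity-stable
  have hSKc : IsCupClosed SK := isCupClosed_opCupSpan
  have hSKΛ : ∀ s ∈ SK, Λ_K s ∈ SK := mem_stabilizerLie_opCupSpan
  have hSKP : ∀ (i : ℕ), ∀ s ∈ SK, (parityOp ℂ (ComplexPoints K) ^ i) s ∈ SK := fun i s hs ↦
    parityOp_pow_mem_opCupSpan (parityOp_comp_eq_of_isDualLefschetz hΛK) (image_degreeClasses_homogeneous _ _) i hs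
  -- `T ⊇ H^{≤3}(H)`
  have hgenT : degreeClasses ℂ (ComplexPoints H) {0, 1, 2, 3} ⊆ T := by
    intro v hv
    simp only [degreeClasses, Set.mem_iUnion, Set.mem_range] at hv
    obtain ⟨k, hk, z, rfl⟩ := hv
    refine Submodule.mem_comap.2 ?_
    refine totalPullback_ofDegree_mem_map_tensorWith c hc hdeck hS hK hH hact z SK fun d hd w ↦ subset_opCupSpan ?_
    refine ⟨ofDegree ℂ (ComplexPoints H) d w, ofDegree_mem_degreeClasses ?_ w, rfl⟩
    simp only [Set.mem_insert_iff, Set.mem_singleton_iff] at hk ⊢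
    omega
  -- `T` is cup-closed and `Λ_H`-stable
  have hTc : IsCupClosed T := fun v hv w hw ↦ by
    have hv' : totalPullback ℂ (AlgPoints.mapContinuous (L := ℂ) (kummerCover act j)) v ∈ SP := Submodule.mem_comap.1 hv
    have hw' : totalPullback ℂ (AlgPoints.mapContinuous (L := ℂ) (kummerCover act j)) w ∈ SP := Submodule.mem_comap.1 hw
    refine Submodule.mem_comap.2 ?_
    rw [totalPullback_totalCup]
    exact isCupClosed_map_tensorWith hSKc hSKP _ hv' _ hw'
  have hTΛ : Λ_H ∈ stabilizerLie T := fun v hv ↦ by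
    have hv' : totalPullback ℂ (AlgPoints.mapContinuous (L := ℂ) (kummerCover act j)) v ∈ SP := Submodule.mem_comap.1 hv
    refine Submodule.mem_comap.2 ?_
    have h1 := LinearMap.congr_fun hcomm v
    simp only [LinearMap.coe_comp, Function.comp_apply] at h1
    rw [h1]
    exact conj_mem_map_tensorWith hS hK hSKΛ hv'
  have hTtop : ⊤ ≤ T := hgen ▸ opCupSpan_le hgenT hTc hTΛ
  -- conclude on `θ^* = (1, 𝟙)^* ∘ Θ^*`
  rintro _ ⟨w, rfl⟩
  rw [totalPullback_eq_sliceRight_comp hH hact j, LinearMap.comp_apply]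
  exact totalPullback_sliceRight_mem hK (Submodule.mem_comap.1 (hTtop (Submodule.mem_top : w ∈ ⊤)))

/-! ### §3 (⟸): `im θ^* ≤ S_K ⟹ S_H = ⊤` -/

include c hc hdeck hS hK hH hact in
/-- **(⟸)** For the Galois datum, `K` smooth projective, `Λ_A` a dual Lefschetz operator of a class
`x ∈ H²(A)` and the transported operator: if `im θ^* ⊆ ⟨θ^* H^{≤3}(H)⟩_{(Λ_K, ∪)}` then
`⟨H^{≤3}(H)⟩_{(Λ_H, ∪)} = H*(H)`. -/
theorem opCupSpan_eq_top_of_range_le {Λ_H : Module.End ℂ (totalCohomology ℂ (ComplexPoints H))}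
    (hΛA : IsDualLefschetz 2 x Λ_A)
    (hcomm : totalPullback ℂ (AlgPoints.mapContinuous (L := ℂ) (kummerCover act j)) ∘ₗ Λ_H =
      ((kunnethEquiv hS hK).conj (Λ_A.rTensor _ + Λ_K.lTensor _)) ∘ₗ
        totalPullback ℂ (AlgPoints.mapContinuous (L := ℂ) (kummerCover act j)))
    (hrange : LinearMap.range (totalPullback ℂ (AlgPoints.mapContinuous (L := ℂ) j)) ≤
      opCupSpan ℂ (ComplexPoints K) Λ_K
        (totalPullback ℂ (AlgPoints.mapContinuous (L := ℂ) j) '' degreeClasses ℂ (ComplexPoints H) {0, 1, 2, 3})) :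
    opCupSpan ℂ (ComplexPoints H) Λ_H (degreeClasses ℂ (ComplexPoints H) {0, 1, 2, 3}) = ⊤ := by
  classical
  haveI := finite_totalCohomology hS
  set SH := opCupSpan ℂ (ComplexPoints H) Λ_H (degreeClasses ℂ (ComplexPoints H) {0, 1, 2, 3}) with hSH
  set Θs := totalPullback ℂ (AlgPoints.mapContinuous (L := ℂ) (kummerCover act j)) with hΘs
  set U := SH.map Θs with hU
  have hone : ofDegree ℂ (ComplexPoints K) 0 (singularCohomology.one ℂ (ComplexPoints K)) = ofDegree ℂ _ 0 (singularCohomology.one ℂ _) := rfl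
  -- `U` is cup-closed and `Λ_P`-stable
  have hUc : IsCupClosed U := by
    rintro _ ⟨a, ha, rfl⟩ _ ⟨b, hb, rfl⟩
    exact ⟨totalCup ℂ _ a b, isCupClosed_opCupSpan _ ha _ hb, totalPullback_totalCup _ a b⟩
  have hUΛ : ∀ u ∈ U, (kunnethEquiv hS hK).conj (Λ_A.rTensor _ + Λ_K.lTensor _) u ∈ U := by
    rintro _ ⟨a, ha, rfl⟩
    refine ⟨Λ_H a, mem_stabilizerLie_opCupSpan _ ha, ?_⟩
    have h1 := LinearMap.congr_fun hcomm a
    simpa only [LinearMap.coe_comp, Function.comp_apply] using h1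
  -- homogeneous deck-invariant classes of degree `≤ 3` lie in `U`
  have hhom : ∀ {d : ℕ}, d ∈ ({0, 1, 2, 3} : Set ℕ) → ∀ z : complexBetti (A.X ⊗ K) d,
      ofDegree ℂ _ d z ∈ LinearMap.range Θs → ofDegree ℂ _ d z ∈ U := by
    intro d hd z hz
    rw [hΘs, ← hc] at hz
    obtain ⟨w, hw⟩ := exists_ofDegree_preimage c z hz
    rw [hc] at hw
    exact ⟨ofDegree ℂ _ d w, subset_opCupSpan (ofDegree_mem_degreeClasses hd w), hw⟩
  -- Step 1: `m × 1 ∈ U` for all `m ∈ H*(A)`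
  have hX2 : kunnethCross A.X K (ofDegree ℂ (ComplexPoints A.X) 2 x ⊗ₜ
      ofDegree ℂ (ComplexPoints K) 0 (singularCohomology.one ℂ _)) ∈ U := by
    have h1 := kunnethCross_tmul_one_mem_range c hc hdeck (ofDegree ℂ (ComplexPoints A.X) 2 x)
    rw [totalCross_tmul_one, totalPullback_lof] at h1 ⊢
    exact hhom (by simp) _ h1
  have hstep1 : ∀ m : totalCohomology ℂ (ComplexPoints A.X),
      kunnethCross A.X K (m ⊗ₜ ofDegree ℂ (ComplexPoints K) 0 (singularCohomology.one ℂ _)) ∈ U := by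
    intro m
    induction m using DirectSum.induction_on with
    | zero => rw [zero_tmul, map_zero]; exact U.zero_mem
    | add y y' hy hy' => rw [add_tmul, map_add]; exact U.add_mem hy hy'
    | of a x' =>
      rw [← lof_eq_of ℂ]
      change kunnethCross A.X K (ofDegree ℂ (ComplexPoints A.X) a x' ⊗ₜ _) ∈ U
      rcases Nat.lt_or_ge a 4 with ha | ha
      · -- degrees `≤ 3`
        have h1 := kunnethCross_tmul_one_mem_range c hc hdeck (ofDegree ℂ (ComplexPoints A.X) a x')
        rw [totalCross_tmul_one, totalPullback_lof] at h1 ⊢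
        refine hhom ?_ _ h1
        simp only [Set.mem_insert_iff, Set.mem_singleton_iff]
        omega
      rcases ha.eq_or_lt with ha4 | ha5
      · -- degree `4`: `x² ≠ 0` spans `H⁴(A)` (`x` is Lefschetz)
        subst ha4
        have L := Literature.Algebra.Lie.hasLefschetzProperty_of_isSl2Triple (isZGrading_degreeOperator 2) hΛA
        have hmem : ofDegree ℂ (ComplexPoints A.X) 4 x' ∈ degreeSpace (degreeOperator ℂ (ComplexPoints A.X) 2) 2 :=
          ofDegree_mem_degreeSpace 2 4 (by norm_num) x'
        obtain ⟨v, hv, hLv⟩ := (L.bijOn 2).surjOn (by exact_mod_cast hmem)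
        rw [degreeSpace_degreeOperator_eq_range 2 0 (by norm_num)] at hv
        obtain ⟨b0, rfl⟩ := hv
        obtain ⟨c0, rfl⟩ := exists_eq_smul_one_of_isSmoothProjective hS ℂ b0
        have hx' : ofDegree ℂ (ComplexPoints A.X) 4 x' = c0 • totalCup ℂ _ (ofDegree ℂ _ 2 x) (ofDegree ℂ _ 2 x) := by
          rw [← hLv, map_smul, map_smul, pow_two, Module.End.mul_apply, totalLefschetz_eq_totalCup, totalCup_one]
        rw [hx', ← TensorProduct.smul_tmul', map_smul]
        refine U.smul_mem c0 ?_
        rw [← totalCup_totalCross_tmul_one]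
        exact hUc _ hX2 _ hX2
      · -- degrees `≥ 5`: zero
        haveI := subsingleton_complexBetti hS (k := a) (by omega)
        rw [Subsingleton.elim x' 0, map_zero, zero_tmul, map_zero]
        exact U.zero_mem
  -- Step 2: `{s | 1 × s ∈ U} ⊇ S_K`
  set V : Submodule ℂ (totalCohomology ℂ (ComplexPoints K)) := U.comap (kunnethCross A.X K ∘ₗ
    TensorProduct.mk ℂ _ _ (ofDegree ℂ (ComplexPoints A.X) 0 (singularCohomology.one ℂ (ComplexPoints A.X)))) with hV
  have hVmem : ∀ s, s ∈ V ↔ kunnethCross A.X K (ofDegree ℂ (ComplexPoints A.X) 0 (singularCohomology.one ℂ _) ⊗ₜ s) ∈ U :=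
    fun s ↦ Iff.rfl
  have hVgen : totalPullback ℂ (AlgPoints.mapContinuous (L := ℂ) j) '' degreeClasses ℂ (ComplexPoints H) {0, 1, 2, 3} ⊆ V := by
    rintro _ ⟨v, hv, rfl⟩
    simp only [degreeClasses, Set.mem_iUnion, Set.mem_range] at hv
    obtain ⟨d, hd, z, rfl⟩ := hv
    rw [SetLike.mem_coe, hVmem]
    have hR : totalPullback ℂ (AlgPoints.mapContinuous (L := ℂ) j) (ofDegree ℂ _ d z) ∈ fibreRange A K (kummerCover act j) :=
      totalPullback_mem_fibreRange c hc hdeck hS hK hH hact _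
    rw [mem_fibreRange_iff] at hR
    rw [totalPullback_lof, totalCross_one_tmul, totalPullback_lof] at hR ⊢
    exact hhom hd _ hR
  have hVc : IsCupClosed V := fun s hs s' hs' ↦ by
    rw [hVmem] at hs hs' ⊢
    rw [← totalCup_totalCross_one_tmul]
    exact hUc _ hs _ hs'
  have hVΛ : Λ_K ∈ stabilizerLie V := fun s hs ↦ by
    rw [hVmem] at hs ⊢
    have h1 := conj_kunnethCross_tmul hS hK (Λ_A := Λ_A) (Λ_K := Λ_K)
      (ofDegree ℂ (ComplexPoints A.X) 0 (singularCohomology.one ℂ _)) s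
    rw [apply_ofDegree_eq_zero_of_isDualLefschetz hΛA (by norm_num), zero_tmul, map_zero, zero_add] at h1
    rw [← h1]
    exact hUΛ _ hs
  have hRV : fibreRange A K (kummerCover act j) ≤ V := by
    rw [fibreRange_eq_range c hc hdeck hS hK hH hact]
    exact hrange.trans (opCupSpan_le hVgen hVc hVΛ)
  -- Step 3: `im Θ^* = κ(H*(A) ⊗ R) ⊆ U`
  have hIm : LinearMap.range Θs ≤ U := by
    rw [hΘs, range_totalPullback_eq c hc hdeck hS hK]
    rintro _ ⟨t, ht, rfl⟩
    induction ht using Submodule.span_induction with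
    | zero => rw [map_zero]; exact U.zero_mem
    | add u u' _ _ hu hu' => rw [map_add]; exact U.add_mem hu hu'
    | smul r u _ hu => rw [map_smul]; exact U.smul_mem r hu
    | mem u hu =>
      obtain ⟨m, s, hs, rfl⟩ := hu
      rw [← totalCup_totalCross_tmul_one_one_tmul]
      exact hUc _ (hstep1 m) _ ((hVmem s).1 (hRV hs))
  -- Step 4: `Θ^*` is injective
  rw [eq_top_iff]
  rintro w -
  obtain ⟨s, hs, hsw⟩ := hIm ⟨w, rfl⟩
  rwa [← totalPullback_kummerCover_injective c hc hsw]

end Main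

end Summit.Ventures.HodgeKum4.HilbertKummer

end
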